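import Summits.CriticalPhenomena.PercolationContinuityZ3.Theorems.PercNearOneGluingAdditiveGluingThreeRelaysTd
import Summits.CriticalPhenomena.PercolationContinuityZ3.Theorems.PercNearOneGluingAdditiveGluingKnLemma4Pair
import Summits.CriticalPhenomena.PercolationContinuityZ3.Theorems.PercNearOneGluingAdditiveGluingEdgeAffine
import Summits.CriticalPhenomena.PercolationContinuityZ3.Theorems.PercNearOneGluingAdditiveGluingThreeTieFormAssembly
import HarnessLib

/-!
# Crux `PercNearOneGluing.AdditiveGluing` (stmt-CriticalPhenomena-4576): the three-relay case reduces to the FULL tie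
# `τ₁ = τ₂ = τ₃` (relay-gluing transfer along the tied pair, Kozma–Nitzan Lemma 4)

Support file (`--supports stmt-CriticalPhenomena-4576`, lead prim-png-lead-4576).  No definitions, no named facts, no sorries.

Notation: relays `a₁ a₂ a₃`, target `b`, observer `o`, `τᵢ = μ(aᵢ ↔ b)`, E-form event
`E = (o↔a₁ ∪ o↔a₂ ∪ o↔a₃) ∖ o↔b`.  The registered three-relay stub of skeleton v12 (`stub_threeRelaysTieEform_c7`) asks for
`μ(E) ≤ t` whenever `1 − t ≤ τ₃`, `τ₃ = τ₁ ≤ τ₂` (tie of the two worst relays, landed reduction `additiveGluing_pointwise_of_minTie`).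

**Theorem (`threeRelaysTieEform_of_fullTie`).**  It suffices to prove the same E-form under the FULL tie `τ₁ = τ₂ = τ₃`.

Proof (relay gluing).  Raise the weight of the pair `e = s(a₁,a₃)` from `w e` towards `1` (`w_s = w[e ↦ s]`).  Along this path
every probability is affine (`real_update_affine`); `τ₁(s) = τ₃(s)` persists (both gain `μ(a₁↔b, a₃↮b)` per unit); `μ_s(o↔A)` and
`μ_s(o↔b, o↮A)` are constant (the pair lies inside the relay set), so `μ_s(E) = const − μ_s(o↔b)` and
`μ_w(E) = μ_{s}(E) + [μ_s(o↔b) − μ_w(o↔b)]`.  By Kozma–Nitzan's Lemma 4 (landed `knLemma4_pair_glued`: gluing a pair helps a third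
vertex no more than it helps the pair's worse member) `μ_s(o↔b) − μ_w(o↔b) ≤ τ₃(s) − τ₃(w)`, so the E-form at `w` with slack `t`
follows from the E-form at `w_s` with the smaller slack `t − (τ₃(s) − τ₃(w))` (which still satisfies `1 − t' ≤ τ₃(s)`).  Take for `s`
the first point where `τ₂(s) = τ₃(s)` (a full tie: hypothesis) if `τ₂(1) < τ₃(1)`, and `s = 1` otherwise; at `s = 1` the pair is
glued, `{o↔a₁} = {o↔a₃}` a.s., and the claim is the TWO-relay E-form for `{a₂, a₃}` (Kozma–Nitzan Theorem 1, landed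
`additiveGluing_twoRelays_eform_tie`).  Corollary `additiveGluing_of_threeFullTieForm_and_four`: the crux follows from the
full-tie three-relay E-form and the tie instances with at least four relays (composition with the landed
`additiveGluing_of_threeTieForm_and_four`).
[cite: KozmaNitzan2024, Lemma 4 and eq. (9) (pp. 9–10), Theorem 1 (§3.1), §5.3 (p. 34)]
-/

namespace Summit.CriticalPhenomena.PercolationContinuityZ3.Theorems

open MeasureTheory Set Literature.Probability.LatticeModels Literature.Probability.Percolation

noncomputable section
open Classical

variable {n : ℕ}

/-! ### The glue of a pair is the update of one weight -/

/-- For `a₁ ≠ a₃`, the only non-diagonal pair inside `{a₁, a₃}` is `s(a₁, a₃)`. [folklore] -/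
theorem fullTie_pair_cond_iff {a₁ a₃ : Fin n} (h : a₁ ≠ a₃) (e : Sym2 (Fin n)) :
    ((∀ x ∈ e, x ∈ ({a₁, a₃} : Finset (Fin n))) ∧ ¬ e.IsDiag) ↔ e = s(a₁, a₃) := by
  revert e
  refine Sym2.ind (fun x y => ?_)
  rw [Sym2.forall_mem_pair, Sym2.mk_isDiag_iff, Sym2.eq_iff]
  simp only [Finset.mem_insert, Finset.mem_singleton]
  constructor
  · rintro ⟨⟨hx | hx, hy | hy⟩, hne⟩ <;> subst hx <;> subst hy
    · exact absurd rfl hne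
    · exact Or.inl ⟨rfl, rfl⟩
    · exact Or.inr ⟨rfl, rfl⟩
    · exact absurd rfl hne
  · rintro (⟨rfl, rfl⟩ | ⟨rfl, rfl⟩)
    · exact ⟨⟨Or.inl rfl, Or.inr rfl⟩, h⟩
    · exact ⟨⟨Or.inr rfl, Or.inl rfl⟩, fun h' => h h'.symm⟩

/-- Gluing the block `{a₁, a₃}` (`a₁ ≠ a₃`) is setting the weight of `s(a₁, a₃)` to `1`. [folklore] -/
theorem fullTie_glue_pair_eq_update (w : Sym2 (Fin n) → unitInterval) {a₁ a₃ : Fin n} (h : a₁ ≠ a₃) :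
    (fun e : Sym2 (Fin n) => if (∀ x ∈ e, x ∈ ({a₁, a₃} : Finset (Fin n))) ∧ ¬ e.IsDiag then 1 else w e) =
      Function.update w s(a₁, a₃) 1 := by
  funext e
  by_cases he : e = s(a₁, a₃)
  · rw [if_pos ((fullTie_pair_cond_iff h e).2 he), he, Function.update_self]
  · rw [if_neg (mt (fullTie_pair_cond_iff h e).1 he), Function.update_of_ne he]

/-- Pushforward under gluing the pair: `μ_{w[e↦1]}(E) = μ_w{ω | ω ∪ D ∈ E}` with `D` the (one-element) set of non-diagonal
pairs inside `{a₁, a₃}`. [folklore] -/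
theorem fullTie_real_update_one (w : Sym2 (Fin n) → unitInterval) {a₁ a₃ : Fin n} (h : a₁ ≠ a₃)
    (E : Set (BondConfig (Fin n))) :
    (prodBernoulli (Function.update w s(a₁, a₃) 1)).real E =
      (prodBernoulli w).real
        {ω | (ω ∪ {e | (∀ x ∈ e, x ∈ ({a₁, a₃} : Finset (Fin n))) ∧ ¬ e.IsDiag}) ∈ E} := by
  rw [← fullTie_glue_pair_eq_update w h]
  exact stub_gluePushforward n w {a₁, a₃} E

/-- `∃ s ∈ {a₁, a₃}, P s` unfolds to `P a₁ ∨ P a₃`. [folklore] -/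
theorem fullTie_exists_mem_pair {a₁ a₃ : Fin n} {P : Fin n → Prop} :
    (∃ s ∈ ({a₁, a₃} : Finset (Fin n)), P s) ↔ P a₁ ∨ P a₃ := by
  constructor
  · rintro ⟨s, hs, hP⟩
    rcases Finset.mem_insert.1 hs with rfl | hs
    · exact Or.inl hP
    · rw [Finset.mem_singleton] at hs
      subst hs
      exact Or.inr hP
  · rintro (hP | hP)
    · exact ⟨a₁, Finset.mem_insert_self _ _, hP⟩
    · exact ⟨a₃, Finset.mem_insert_of_mem (Finset.mem_singleton_self _), hP⟩

/-- Reachability after gluing the pair `{a₁, a₃}`, pointwise. [folklore] -/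
theorem fullTie_glueReach_pair (a₁ a₃ : Fin n) (ω : BondConfig (Fin n)) (x y : Fin n) :
    (ω ∪ {e | (∀ z ∈ e, z ∈ ({a₁, a₃} : Finset (Fin n))) ∧ ¬ e.IsDiag}) ∈ (openConn x y : Set (BondConfig (Fin n))) ↔
      (ω ∈ (openConn x y : Set (BondConfig (Fin n))) ∨
        ((ω ∈ (openConn x a₁ : Set (BondConfig (Fin n))) ∨ ω ∈ (openConn x a₃ : Set (BondConfig (Fin n)))) ∧
          (ω ∈ (openConn a₁ y : Set (BondConfig (Fin n))) ∨ ω ∈ (openConn a₃ y : Set (BondConfig (Fin n)))))) := by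
  rw [stub_glueReach n {a₁, a₃} ω x y, fullTie_exists_mem_pair, fullTie_exists_mem_pair]

/-- Every configuration lies in `{x ↔ x}`. [folklore] -/
theorem fullTie_mem_openConn_self (x : Fin n) (ω : BondConfig (Fin n)) :
    ω ∈ (openConn x x : Set (BondConfig (Fin n))) :=
  SimpleGraph.Reachable.refl _

/-- The union over the pair `{a₁, a₃}` of the events `{s ↔ y}`. [folklore] -/
theorem fullTie_biUnion_pair (a₁ a₃ y : Fin n) :
    (⋃ s ∈ ({a₁, a₃} : Finset (Fin n)), (openConn s y : Set (BondConfig (Fin n)))) = openConn a₁ y ∪ openConn a₃ y := by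
  ext ω
  simp only [Set.mem_iUnion, exists_prop, Set.mem_union]
  exact fullTie_exists_mem_pair

/-! ### Probabilities after gluing the pair `{a₁, a₃}` (`μ₁ = μ_{w[s(a₁,a₃) ↦ 1]}`) -/

/-- `μ₁(a₃ ↔ b) = μ(a₁↔b ∪ a₃↔b)`. [folklore] -/
theorem fullTie_tau3_one (w : Sym2 (Fin n) → unitInterval) {a₁ a₃ : Fin n} (h : a₁ ≠ a₃) (b : Fin n) :
    (prodBernoulli (Function.update w s(a₁, a₃) 1)).real (openConn a₃ b) =
      (prodBernoulli w).real (openConn a₁ b ∪ openConn a₃ b : Set (BondConfig (Fin n))) := by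
  rw [fullTie_real_update_one w h]
  congr 1
  ext ω
  rw [Set.mem_setOf_eq, fullTie_glueReach_pair]
  have h33 := fullTie_mem_openConn_self a₃ ω
  simp only [Set.mem_union]
  tauto

/-- `μ₁(a₁ ↔ b) = μ(a₁↔b ∪ a₃↔b)`. [folklore] -/
theorem fullTie_tau1_one (w : Sym2 (Fin n) → unitInterval) {a₁ a₃ : Fin n} (h : a₁ ≠ a₃) (b : Fin n) :
    (prodBernoulli (Function.update w s(a₁, a₃) 1)).real (openConn a₁ b) =
      (prodBernoulli w).real (openConn a₁ b ∪ openConn a₃ b : Set (BondConfig (Fin n))) := by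
  rw [fullTie_real_update_one w h]
  congr 1
  ext ω
  rw [Set.mem_setOf_eq, fullTie_glueReach_pair]
  have h11 := fullTie_mem_openConn_self a₁ ω
  simp only [Set.mem_union]
  tauto

/-- The observer's reach of the three relays is unchanged by gluing two of them:
`μ₁(o↔a₁ ∪ o↔a₂ ∪ o↔a₃) = μ(o↔a₁ ∪ o↔a₂ ∪ o↔a₃)`. [folklore] -/
theorem fullTie_reachA_one (w : Sym2 (Fin n) → unitInterval) {a₁ a₃ : Fin n} (h : a₁ ≠ a₃) (o a₂ : Fin n) :
    (prodBernoulli (Function.update w s(a₁, a₃) 1)).real (openConn o a₁ ∪ openConn o a₂ ∪ openConn o a₃) =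
      (prodBernoulli w).real (openConn o a₁ ∪ openConn o a₂ ∪ openConn o a₃ : Set (BondConfig (Fin n))) := by
  rw [fullTie_real_update_one w h]
  congr 1
  ext ω
  simp only [Set.mem_setOf_eq, Set.mem_union]
  rw [fullTie_glueReach_pair, fullTie_glueReach_pair, fullTie_glueReach_pair]
  tauto

/-- `μ₁(o↔b, o↮A) = μ(o↔b, o↮A)` for `A = {a₁, a₂, a₃}`: off the observer's reach of the relays the glued pair is invisible.
[folklore] -/
theorem fullTie_roomB_one (w : Sym2 (Fin n) → unitInterval) {a₁ a₃ : Fin n} (h : a₁ ≠ a₃) (o a₂ b : Fin n) :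
    (prodBernoulli (Function.update w s(a₁, a₃) 1)).real
        (openConn o b ∩ (openConn o a₁ ∪ openConn o a₂ ∪ openConn o a₃)ᶜ) =
      (prodBernoulli w).real (openConn o b ∩ (openConn o a₁ ∪ openConn o a₂ ∪ openConn o a₃)ᶜ : Set (BondConfig (Fin n))) := by
  rw [fullTie_real_update_one w h]
  congr 1
  ext ω
  simp only [Set.mem_setOf_eq, Set.mem_inter_iff, Set.mem_compl_iff, Set.mem_union]
  rw [fullTie_glueReach_pair, fullTie_glueReach_pair, fullTie_glueReach_pair, fullTie_glueReach_pair]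
  tauto

/-- After gluing the pair, `{o↔a₁} ∖ {o↔a₃}` is null. [folklore] -/
theorem fullTie_diff13_one (w : Sym2 (Fin n) → unitInterval) {a₁ a₃ : Fin n} (h : a₁ ≠ a₃) (o : Fin n) :
    (prodBernoulli (Function.update w s(a₁, a₃) 1)).real (openConn o a₁ \ openConn o a₃) = 0 := by
  rw [fullTie_real_update_one w h]
  have hempty : {ω : BondConfig (Fin n) | (ω ∪ {e | (∀ x ∈ e, x ∈ ({a₁, a₃} : Finset (Fin n))) ∧ ¬ e.IsDiag}) ∈
      (openConn o a₁ \ openConn o a₃ : Set (BondConfig (Fin n)))} = ∅ := by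
    ext ω
    simp only [Set.mem_setOf_eq, Set.mem_sdiff, Set.mem_empty_iff_false, iff_false, not_and, not_not]
    rw [fullTie_glueReach_pair, fullTie_glueReach_pair]
    have h33 := fullTie_mem_openConn_self a₃ ω
    tauto
  rw [hempty, measureReal_empty]

/-- **Kozma–Nitzan Lemma 4 along the tied pair**: if `τ₃ ≤ τ₁` then the observer's gain from gluing `{a₁,a₃}` is at most
`a₃`'s gain: `μ₁(o↔b) − μ(o↔b) ≤ μ₁(a₃↔b) − μ(a₃↔b)`. [cite: KozmaNitzan2024, Lemma 4 / eq. (9) (pp. 9–10)] -/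
theorem fullTie_gain_obs_le (w : Sym2 (Fin n) → unitInterval) {a₁ a₃ : Fin n} (h : a₁ ≠ a₃) (o b : Fin n)
    (h31 : (prodBernoulli w).real (openConn a₃ b) ≤ (prodBernoulli w).real (openConn a₁ b)) :
    (prodBernoulli (Function.update w s(a₁, a₃) 1)).real (openConn o b) - (prodBernoulli w).real (openConn o b) ≤
      (prodBernoulli (Function.update w s(a₁, a₃) 1)).real (openConn a₃ b) - (prodBernoulli w).real (openConn a₃ b) := by
  obtain ⟨s, hs, hle⟩ := knLemma4_pair_glued w {a₁, a₃} o b (Finset.card_pair h)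
  rw [fullTie_glue_pair_eq_update w h, fullTie_biUnion_pair] at hle
  rw [fullTie_tau3_one w h]
  have hmin : (prodBernoulli w).real (openConn a₃ b) ≤ (prodBernoulli w).real (openConn s b) := by
    rcases fullTie_exists_mem_pair.1 ⟨s, hs, rfl⟩ with hs1 | hs3
    · rw [hs1]; exact h31
    · rw [hs3]
  linarith

/-- Measure algebra: `μ(E) + μ(o↔b) = μ(o↔A) + μ(o↔b, o↮A)` with `E = o↔A ∖ o↔b`. [folklore] -/
theorem fullTie_eform_add (μw : Sym2 (Fin n) → unitInterval) (OA Ob : Set (BondConfig (Fin n))) :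
    (prodBernoulli μw).real (OA \ Ob) + (prodBernoulli μw).real Ob =
      (prodBernoulli μw).real OA + (prodBernoulli μw).real (Ob ∩ OAᶜ) := by
  have hm : ∀ s : Set (BondConfig (Fin n)), MeasurableSet s := fun _ => MeasurableSet.of_discrete
  have h1 := measureReal_inter_add_sdiff (μ := prodBernoulli μw) (s := OA) (hm Ob)
  have h2 := measureReal_inter_add_sdiff (μ := prodBernoulli μw) (s := Ob) (hm OA)
  rw [Set.inter_comm] at h2
  rw [Set.sdiff_eq] at h1 h2 ⊢
  linarith

/-! ### The reduction -/

/-- **The three-relay tie-locus E-form follows from its full-tie instances** (`τ₁ = τ₂ = τ₃`): the extra hypothesis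
`τ₂ ≤ τ₃` may be assumed in `stub_threeRelaysTieEform_c7`.  See the file header for the proof.
[cite: KozmaNitzan2024, Lemma 4 (p. 9), Theorem 1 (§3.1), §5.3 (p. 34)] -/
theorem threeRelaysTieEform_of_fullTie
    (hfull : ∀ (n : ℕ) (w : Sym2 (Fin n) → unitInterval) (o b a₁ a₂ a₃ : Fin n) (t : ℝ),
      a₁ ≠ a₂ → a₁ ≠ a₃ → a₂ ≠ a₃ →
      1 - t ≤ (prodBernoulli w).real (openConn a₃ b) →
      (prodBernoulli w).real (openConn a₃ b) ≤ (prodBernoulli w).real (openConn a₁ b) →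
      (prodBernoulli w).real (openConn a₃ b) ≤ (prodBernoulli w).real (openConn a₂ b) →
      (prodBernoulli w).real (openConn a₁ b) ≤ (prodBernoulli w).real (openConn a₃ b) →
      (prodBernoulli w).real (openConn a₂ b) ≤ (prodBernoulli w).real (openConn a₃ b) →
      (prodBernoulli w).real ((openConn o a₁ ∪ openConn o a₂ ∪ openConn o a₃) \ openConn o b) ≤ t) :
    ∀ (n : ℕ) (w : Sym2 (Fin n) → unitInterval) (o b a₁ a₂ a₃ : Fin n) (t : ℝ),
      a₁ ≠ a₂ → a₁ ≠ a₃ → a₂ ≠ a₃ →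
      1 - t ≤ (prodBernoulli w).real (openConn a₃ b) →
      (prodBernoulli w).real (openConn a₃ b) ≤ (prodBernoulli w).real (openConn a₁ b) →
      (prodBernoulli w).real (openConn a₃ b) ≤ (prodBernoulli w).real (openConn a₂ b) →
      (prodBernoulli w).real (openConn a₁ b) ≤ (prodBernoulli w).real (openConn a₃ b) →
      (prodBernoulli w).real ((openConn o a₁ ∪ openConn o a₂ ∪ openConn o a₃) \ openConn o b) ≤ t := by
  intro n w o b a₁ a₂ a₃ t h12 h13 h23 ht h31 h32 h13'
  have hm : ∀ s : Set (BondConfig (Fin n)), MeasurableSet s := fun _ => MeasurableSet.of_discrete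
  -- the pair to glue and the glued weighting
  set e : Sym2 (Fin n) := s(a₁, a₃) with he
  set w1 : Sym2 (Fin n) → unitInterval := Function.update w e 1 with hw1
  -- events
  set OA : Set (BondConfig (Fin n)) := openConn o a₁ ∪ openConn o a₂ ∪ openConn o a₃ with hOA
  set Ob : Set (BondConfig (Fin n)) := openConn o b with hOb
  -- glued-vs-unglued facts
  have hT3 : (prodBernoulli w1).real (openConn a₃ b) = (prodBernoulli w).real (openConn a₁ b ∪ openConn a₃ b) :=
    fullTie_tau3_one w h13 b
  have hT1 : (prodBernoulli w1).real (openConn a₁ b) = (prodBernoulli w).real (openConn a₁ b ∪ openConn a₃ b) :=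
    fullTie_tau1_one w h13 b
  have hOA1 : (prodBernoulli w1).real OA = (prodBernoulli w).real OA := fullTie_reachA_one w h13 o a₂
  have hR1 : (prodBernoulli w1).real (Ob ∩ OAᶜ) = (prodBernoulli w).real (Ob ∩ OAᶜ) := fullTie_roomB_one w h13 o a₂ b
  have hgain : (prodBernoulli w1).real Ob - (prodBernoulli w).real Ob ≤
      (prodBernoulli w1).real (openConn a₃ b) - (prodBernoulli w).real (openConn a₃ b) :=
    fullTie_gain_obs_le w h13 o b h31
  have hEw := fullTie_eform_add w OA Ob
  have hE1 := fullTie_eform_add w1 OA Ob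
  -- τ₃ grows under the gluing
  have hT3ge : (prodBernoulli w).real (openConn a₃ b) ≤ (prodBernoulli w1).real (openConn a₃ b) := by
    rw [hT3]; exact measureReal_mono Set.subset_union_right (measure_ne_top _ _)
  by_cases hA : (prodBernoulli w1).real (openConn a₃ b) ≤ (prodBernoulli w1).real (openConn a₂ b)
  · -- Case A: at `s = 1` the pair is glued and the two-relay E-form for `{a₂, a₃}` applies
    have h2 := additiveGluing_twoRelays_eform_tie w1 o b a₂ a₃ hA
    have hc3 : (prodBernoulli w1).real ((openConn a₃ b)ᶜ : Set (BondConfig (Fin n))) =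
        1 - (prodBernoulli w1).real (openConn a₃ b : Set (BondConfig (Fin n))) := probReal_compl_eq_one_sub (hm _)
    have hnull := fullTie_diff13_one w h13 o
    have hsub : (OA \ Ob) ⊆ ((openConn o a₂ ∪ openConn o a₃) \ openConn o b) ∪ (openConn o a₁ \ openConn o a₃) := by
      intro ω hω
      have hA' : ω ∈ OA := hω.1
      have hb : ω ∉ Ob := hω.2
      rw [hOA] at hA'
      rcases hA' with (h1 | h2) | h3
      · by_cases h3' : ω ∈ (openConn o a₃ : Set (BondConfig (Fin n)))
        · exact Or.inl ⟨Or.inr h3', hb⟩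
        · exact Or.inr ⟨h1, h3'⟩
      · exact Or.inl ⟨Or.inl h2, hb⟩
      · exact Or.inl ⟨Or.inr h3, hb⟩
    have hle : (prodBernoulli w1).real (OA \ Ob) ≤
        (prodBernoulli w1).real ((openConn o a₂ ∪ openConn o a₃) \ openConn o b) +
          (prodBernoulli w1).real (openConn o a₁ \ openConn o a₃) :=
      (measureReal_mono hsub (measure_ne_top _ _)).trans (measureReal_union_le _ _)
    -- transfer back to `w`: `μ_w(E) = μ₁(E) + (μ₁(o↔b) − μ_w(o↔b))`
    linarith
  · -- Case B: `τ₂(1) < τ₃(1)`; interpolate along the weight of `e` up to the full tie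
    push Not at hA
    -- `w e < 1` (otherwise `w = w1`)
    have hq1 : (w e : ℝ) < 1 := by
      by_contra hge
      have hwe1 : (w e : ℝ) = 1 := le_antisymm (w e).2.2 (not_lt.1 hge)
      have hw : w = w1 := by
        rw [hw1]
        have : w e = 1 := Subtype.ext hwe1
        rw [← this, Function.update_eq_self]
      rw [← hw] at hA
      linarith
    -- affine parametrisation
    set w0 : Sym2 (Fin n) → unitInterval := Function.update w e 0 with hw0
    let P0 : Set (BondConfig (Fin n)) → ℝ := fun S => (prodBernoulli w0).real S
    let P1 : Set (BondConfig (Fin n)) → ℝ := fun S => (prodBernoulli w1).real S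
    have hL : ∀ (S : Set (BondConfig (Fin n))) (s : ℝ), s ∈ Set.Icc (0:ℝ) 1 →
        (prodBernoulli (Function.update w e (Set.projIcc (0:ℝ) 1 zero_le_one s))).real S = P0 S + s * (P1 S - P0 S) :=
      fun S s hs => real_update_affine w e S hs
    have hwe : Function.update w e (Set.projIcc (0:ℝ) 1 zero_le_one (w e : ℝ)) = w := by
      have : Set.projIcc (0:ℝ) 1 zero_le_one (w e : ℝ) = w e := by
        rw [Set.projIcc_of_mem _ ⟨(w e).2.1, (w e).2.2⟩]
      rw [this, Function.update_eq_self]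
    have hwe_mem : ((w e : ℝ)) ∈ Set.Icc (0:ℝ) 1 := ⟨(w e).2.1, (w e).2.2⟩
    set q : ℝ := (w e : ℝ) with hq
    -- value at `w` of every probability in terms of `P0, P1`
    have hPq : ∀ S : Set (BondConfig (Fin n)), (prodBernoulli w).real S = P0 S + q * (P1 S - P0 S) := by
      intro S
      have := hL S q hwe_mem
      rwa [hwe] at this
    -- the interpolation parameter `λ ∈ [0,1]` of the full tie between `s = q` and `s = 1`
    set gq : ℝ := (prodBernoulli w).real (openConn a₂ b) - (prodBernoulli w).real (openConn a₃ b) with hgq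
    set g1 : ℝ := (prodBernoulli w1).real (openConn a₂ b) - (prodBernoulli w1).real (openConn a₃ b) with hg1
    have hgq0 : 0 ≤ gq := by rw [hgq]; linarith
    have hg10 : g1 < 0 := by rw [hg1]; linarith
    have hden : 0 < gq - g1 := by linarith
    set lam : ℝ := gq / (gq - g1) with hlam
    have hlam0 : 0 ≤ lam := div_nonneg hgq0 hden.le
    have hlam1 : lam ≤ 1 := by rw [hlam, div_le_one hden]; linarith
    set r : ℝ := q + lam * (1 - q) with hr
    have hr_mem : r ∈ Set.Icc (0:ℝ) 1 := by
      constructor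
      · rw [hr]; nlinarith [hwe_mem.1, hwe_mem.2]
      · rw [hr]; nlinarith [hwe_mem.1, hwe_mem.2]
    set wr : Sym2 (Fin n) → unitInterval := Function.update w e (Set.projIcc (0:ℝ) 1 zero_le_one r) with hwr
    -- every probability at `wr` is the `λ`-interpolation between its values at `w` and at `w1`
    have hPr : ∀ S : Set (BondConfig (Fin n)),
        (prodBernoulli wr).real S = (prodBernoulli w).real S + lam * ((prodBernoulli w1).real S - (prodBernoulli w).real S) := by
      intro S
      rw [hwr, hL S r hr_mem, hPq S]
      show P0 S + r * (P1 S - P0 S) = P0 S + q * (P1 S - P0 S) + lam * (P1 S - (P0 S + q * (P1 S - P0 S)))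
      rw [hr]; ring
    -- hypotheses of the full-tie form at `wr`
    have hT3r := hPr (openConn a₃ b)
    have hT1r := hPr (openConn a₁ b)
    have hT2r := hPr (openConn a₂ b)
    have hObr := hPr Ob
    have hOAr := hPr OA
    have hRr := hPr (Ob ∩ OAᶜ)
    have hEr := fullTie_eform_add wr OA Ob
    have htie13 : (prodBernoulli w).real (openConn a₁ b) = (prodBernoulli w).real (openConn a₃ b) := le_antisymm h13' h31
    -- `τ₂(r) = τ₃(r)` by the choice of `λ`
    have hlam_eq : lam * (gq - g1) = gq := by rw [hlam]; field_simp
    have h23r : (prodBernoulli wr).real (openConn a₂ b) = (prodBernoulli wr).real (openConn a₃ b) := by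
      rw [hT2r, hT3r]
      have : gq + lam * (g1 - gq) = 0 := by linarith
      rw [hgq, hg1] at this
      linarith
    have h13r : (prodBernoulli wr).real (openConn a₁ b) = (prodBernoulli wr).real (openConn a₃ b) := by
      rw [hT1r, hT3r, htie13, hT1, hT3]
    set t' : ℝ := t - lam * ((prodBernoulli w1).real (openConn a₃ b) - (prodBernoulli w).real (openConn a₃ b)) with ht'
    have ht'r : 1 - t' ≤ (prodBernoulli wr).real (openConn a₃ b) := by rw [ht', hT3r]; linarith
    have hfr := hfull n wr o b a₁ a₂ a₃ t' h12 h13 h23 ht'r (le_of_eq h13r.symm) (le_of_eq h23r.symm) (le_of_eq h13r)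
      (le_of_eq h23r)
    -- transfer back to `w`
    have hgain' : lam * ((prodBernoulli w1).real Ob - (prodBernoulli w).real Ob) ≤
        lam * ((prodBernoulli w1).real (openConn a₃ b) - (prodBernoulli w).real (openConn a₃ b)) :=
      mul_le_mul_of_nonneg_left hgain hlam0
    have hEqr : (prodBernoulli wr).real (OA \ Ob) = (prodBernoulli w).real (OA \ Ob) - lam * ((prodBernoulli w1).real Ob - (prodBernoulli w).real Ob) := by
      have h1 : (prodBernoulli wr).real OA = (prodBernoulli w).real OA := by rw [hOAr, hOA1]; ring
      have h2 : (prodBernoulli wr).real (Ob ∩ OAᶜ) = (prodBernoulli w).real (Ob ∩ OAᶜ) := by rw [hRr, hR1]; ring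
      linarith
    linarith

/-- **`AdditiveGluing` from the FULL-TIE three-relay E-form and the tie instances with at least four relays**
(skeleton composition: `additiveGluing_of_threeTieForm_and_four` after `threeRelaysTieEform_of_fullTie`).
[cite: KozmaNitzan2024, §5.3 (p. 34), Theorem 1 (§3.1), Lemma 4 (p. 9)] -/
theorem additiveGluing_of_threeFullTieForm_and_four
    (h3full : ∀ (n : ℕ) (w : Sym2 (Fin n) → unitInterval) (o b a₁ a₂ a₃ : Fin n) (t : ℝ),
      a₁ ≠ a₂ → a₁ ≠ a₃ → a₂ ≠ a₃ →
      1 - t ≤ (prodBernoulli w).real (openConn a₃ b) →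
      (prodBernoulli w).real (openConn a₃ b) ≤ (prodBernoulli w).real (openConn a₁ b) →
      (prodBernoulli w).real (openConn a₃ b) ≤ (prodBernoulli w).real (openConn a₂ b) →
      (prodBernoulli w).real (openConn a₁ b) ≤ (prodBernoulli w).real (openConn a₃ b) →
      (prodBernoulli w).real (openConn a₂ b) ≤ (prodBernoulli w).real (openConn a₃ b) →
      (prodBernoulli w).real ((openConn o a₁ ∪ openConn o a₂ ∪ openConn o a₃) \ openConn o b) ≤ t)
    (hFour : ∀ (n : ℕ) (w : Sym2 (Fin n) → unitInterval) (A : Finset (Fin n)) (o b : Fin n) (t : ℝ), 4 ≤ (A.erase b).card → (∃ a ∈ A, ∃ a' ∈ A, a ≠ a' ∧ (prodBernoulli w).real (openConn a b) = (prodBernoulli w).real (openConn a' b) ∧ ∀ c ∈ A, (prodBernoulli w).real (openConn a b) ≤ (prodBernoulli w).real (openConn c b)) → 0 ≤ t → (∀ a ∈ A, 1 - t ≤ (prodBernoulli w).real (openConn a b)) → (prodBernoulli w).real (⋃ a ∈ A, openConn o a) - t ≤ (prodBernoulli w).real (openConn o b)) :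
    Summit.CriticalPhenomena.PercolationContinuityZ3.Theses.PercNearOneGluing.AdditiveGluing :=
  additiveGluing_of_threeTieForm_and_four (threeRelaysTieEform_of_fullTie h3full) hFour

end

end Summit.CriticalPhenomena.PercolationContinuityZ3.Theorems
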